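import Summits.Langlands.Langlands.Theses.DisagreementBeurling

open scoped BigOperators Topology Manifold Classical MeasureTheory ProbabilityTheory Matrix InnerProductSpace ComplexConjugate ContinuousMap
open Filter Set Function TopologicalSpace MeasureTheory

set_option linter.dupNamespace false

/-!
# Birth skeleton of the piece X₁ `HessianQuadraticLayer` (split child of `CanonicalDescent36`)

Two stubs: (A) `stub_layerStructure` — the finite group theory of the Hessian group `3²:4 ⊂ PGL₃(ℂ)`:
the quadratic layer `M/F`, irreducibility and monomiality of `ρ|_{Γ_M}`, and the EXACT membership
dictionary "`σ ∈ Γ_M` ⇔ the eigenvalue multiset of `ρ(σ)` does not have exactly two distinct squares"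
(shape table (1,1),(2,1),(3,3),(3,2)); (B) `stub_frobeniusDegreeOne` — pure algebraic number theory:
for ANY extension `M/F` and any `ρ` with that membership dictionary, a Frobenius class without two
distinct squares at `v` yields a degree-one prime of `M` over `v` (an arithmetic Frobenius fixing the
copy of `M` in `F̄` has residue degree one on it) — at EVERY `v`, no exceptional set.
`HessianQuadraticLayer_of` composes them (sorry-free).
-/

namespace Summit.Langlands.Langlands.Cruxes.CanonicalDescent36.Birth.HessianQuadraticLayer

/-- The piece X₁ (verbatim the split child `HessianQuadraticLayer`). -/
def Piece : Prop :=
  ∀ (F : Type) [Field F] [NumberField F] (ρ : Literature.NumberTheory.GaloisRepresentations.FramedGaloisRep F ℂ 3), ρ.toGaloisRep.IsIrreducible → (Nat.card (Matrix.ProjGenLinGroup.mk.comp ρ.toMonoidHom).range = 36 ∧ Subgroup.center (Matrix.ProjGenLinGroup.mk.comp ρ.toMonoidHom).range = ⊥ ∧ ∃ g : (Matrix.ProjGenLinGroup.mk.comp ρ.toMonoidHom).range, orderOf g = 4) → ∃ (M : Type) (_ : Field M) (_ : NumberField M) (_ : Algebra F M), Module.finrank F M = 2 ∧ (ρ.restrictField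 M).toGaloisRep.IsIrreducible ∧ (∃ g : GL (Fin 3) ℂ, ∀ (σ : Field.absoluteGaloisGroup M) (i : Fin 3), ∃! j : Fin 3, ((Literature.NumberTheory.GaloisRepresentations.FramedRep.conj g (ρ.restrictField M) σ : GL (Fin 3) ℂ) : Matrix (Fin 3) (Fin 3) ℂ) i j ≠ 0) ∧ ∀ᶠ v : IsDedekindDomain.HeightOneSpectrum (NumberField.RingOfIntegers F) in Filter.cofinite, ∀ β : Multiset ℂ, ρ.HasFrobCharpolyAt v (Literature.NumberTheory.Automorphic.satakePolynomial β) → (β.map (· ^ 2)).toFinset.card ≠ 2 → ∃ w : IsDedekindDomain.HeightOneSpectrum (NumberField.RingOfIntegers M), w.asIdeal.under (NumberField.RingOfIntegers F) = v.asIdeal ∧ w.asIdeal.inertiaDeg (NumberField.RingOfIntegers F) = 1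

/-- STUB A — layer structure of a `3²:4`-type `ρ` (group theory; size M). -/
theorem stub_layerStructure :
    ∀ (F : Type) [Field F] [NumberField F] (ρ : Literature.NumberTheory.GaloisRepresentations.FramedGaloisRep F ℂ 3), ρ.toGaloisRep.IsIrreducible → (Nat.card (Matrix.ProjGenLinGroup.mk.comp ρ.toMonoidHom).range = 36 ∧ Subgroup.center (Matrix.ProjGenLinGroup.mk.comp ρ.toMonoidHom).range = ⊥ ∧ ∃ g : (Matrix.ProjGenLinGroup.mk.comp ρ.toMonoidHom).range, orderOf g = 4) → ∃ (M : Type) (_ : Field M) (_ : NumberField M) (_ : Algebra F M), Module.finrank F M = 2 ∧ (ρ.restrictField M).toGaloisRep.IsIrreducible ∧ (∃ g : GL (Fin 3) ℂ, ∀ (σ : Field.absoluteGaloisGroup M) (i : Fin 3), ∃! j : Fin 3, ((Literature.NumberTheory.GaloisRepresentations.FramedRep.conj g (ρ.restrictField M) σ : GL (Fin 3) ℂ) : Matrix (Fin 3) (Fin 3) ℂ) i j ≠ 0) ∧ (∀ σ : Field.absoluteGaloisGroup F, σ ∈ Set.range (Literature.NumberTheory.GaloisRepresentations.absGaloisRestrict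 F M) ↔ (((Literature.NumberTheory.GaloisRepresentations.FramedRep.charpoly ρ σ).roots.map (· ^ 2)).toFinset.card ≠ 2)) := by
  sorry

/-- STUB B — Frobenius classes in the image of `Γ_M` give degree-one primes (Dedekind/Galois
bookkeeping with `IsArithFrobAt`; size M). -/
theorem stub_frobeniusDegreeOne :
    ∀ (F : Type) [Field F] [NumberField F] (M : Type) [Field M] [NumberField M] [Algebra F M] (ρ : Literature.NumberTheory.GaloisRepresentations.FramedGaloisRep F ℂ 3), (∀ σ : Field.absoluteGaloisGroup F, σ ∈ Set.range (Literature.NumberTheory.GaloisRepresentations.absGaloisRestrict F M) ↔ (((Literature.NumberTheory.GaloisRepresentations.FramedRep.charpoly ρ σ).roots.map (· ^ 2)).toFinset.card ≠ 2)) → ∀ (v : IsDedekindDomain.HeightOneSpectrum (NumberField.RingOfIntegers F)) (β : Multiset ℂ), ρ.HasFrobCharpolyAt v (Literature.NumberTheory.Automorphic.satakePolynomial β) → (β.map (· ^ 2)).toFinset.card ≠ 2 → (∃ w : IsDedekindDomain.HeightOneSpectrum (NumberField.RingOfIntegers M), w.asIdeal.under (NumberField.RingOfIntegers F) = v.asIdeal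 ∧ w.asIdeal.inertiaDeg (NumberField.RingOfIntegers F) = 1) := by
  sorry

/-- X₁ from the two stubs (statement level, sorry-free). -/
theorem piece_of_statements :
    (∀ (F : Type) [Field F] [NumberField F] (ρ : Literature.NumberTheory.GaloisRepresentations.FramedGaloisRep F ℂ 3), ρ.toGaloisRep.IsIrreducible → (Nat.card (Matrix.ProjGenLinGroup.mk.comp ρ.toMonoidHom).range = 36 ∧ Subgroup.center (Matrix.ProjGenLinGroup.mk.comp ρ.toMonoidHom).range = ⊥ ∧ ∃ g : (Matrix.ProjGenLinGroup.mk.comp ρ.toMonoidHom).range, orderOf g = 4) → ∃ (M : Type) (_ : Field M) (_ : NumberField M) (_ : Algebra F M), Module.finrank F M = 2 ∧ (ρ.restrictField M).toGaloisRep.IsIrreducible ∧ (∃ g : GL (Fin 3) ℂ, ∀ (σ : Field.absoluteGaloisGroup M) (i : Fin 3), ∃! j : Fin 3, ((Literature.NumberTheory.GaloisRepresentations.FramedRep.conj g (ρ.restrictField M) σ : GL (Fin 3) ℂ) : Matrix (Fin 3) (Fin 3) ℂ) i j ≠ 0) ∧ (∀ σ : Field.absoluteGaloisGroup F, σ ∈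 Set.range (Literature.NumberTheory.GaloisRepresentations.absGaloisRestrict F M) ↔ (((Literature.NumberTheory.GaloisRepresentations.FramedRep.charpoly ρ σ).roots.map (· ^ 2)).toFinset.card ≠ 2))) → (∀ (F : Type) [Field F] [NumberField F] (M : Type) [Field M] [NumberField M] [Algebra F M] (ρ : Literature.NumberTheory.GaloisRepresentations.FramedGaloisRep F ℂ 3), (∀ σ : Field.absoluteGaloisGroup F, σ ∈ Set.range (Literature.NumberTheory.GaloisRepresentations.absGaloisRestrict F M) ↔ (((Literature.NumberTheory.GaloisRepresentations.FramedRep.charpoly ρ σ).roots.map (· ^ 2)).toFinset.card ≠ 2)) → ∀ (v : IsDedekindDomain.HeightOneSpectrum (NumberField.RingOfIntegers F)) (β : Multiset ℂ), ρ.HasFrobCharpolyAt v (Literature.NumberTheory.Automorphic.satakePolynomial β) → (β.map (· ^ 2)).toFinset.card ≠ 2 → (∃ w : IsDedekindDomain.HeightOneSpectrum (NumberField.RingOfIntegers M), w.asIdeal.under (NumberField.RingOfIntegers F) = v.asIdeal ∧ w.asIdeal.inertiaDeg (NumberField.RingOfIntegers F) = 1)) → Piece := by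
  intro hA hB F _ _ ρ hirr htype
  obtain ⟨M, _, _, _, hdeg, hirrM, hmono, hdict⟩ := hA F ρ hirr htype
  exact ⟨M, inferInstance, inferInstance, inferInstance, hdeg, hirrM, hmono,
    Filter.Eventually.of_forall fun v β hβ hne => hB F M ρ hdict v β hβ hne⟩

/-- X₁ `HessianQuadraticLayer` from the registered stubs. -/
theorem HessianQuadraticLayer_of : Piece :=
  piece_of_statements stub_layerStructure stub_frobeniusDegreeOne

end Summit.Langlands.Langlands.Cruxes.CanonicalDescent36.Birth.HessianQuadraticLayer
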